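import Mathlib.Data.Finset.Powerset
import Mathlib.Data.Fintype.Powerset
import Mathlib.Data.Finset.Sort
import Literature.Computability.MetaComplexity.NWGenerator
import HarnessLib

/-!
# Nisan–Wigderson designs with a LINEAR universe: existence by counting

Topic `Computability/MetaComplexity`, continuing `NWGenerator.lean` (whose designs come from
polynomials over a prime field and live in a universe of size `≈ ℓ²` with SMALL intersections).
Hardness amplification and the NP-hardness of `MCSP*` need the other regime of the
Nisan–Wigderson lemma: blocks of size `ℓ`, LARGE intersections `ρ = ℓ / b` for a constant `b`, and a
universe of size `d = O(ℓ)` (so that seeds have length `O(ℓ)`):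

* Hirahara, FOCS 2022 / ECCC TR22-119, Prop. 6.2 ([NW94; Tre01]): "for any sufficiently large
  `ℓ, m, ρ` with `m ≤ 2^ℓ` there exists a design `S₁, …, S_m ⊆ [d]` with `|Sᵢ| = ℓ`,
  `d = O(exp(ℓ/ρ) · ℓ²/ρ)` and `|Sᵢ ∩ Sⱼ| ≤ ρ` (`i ≠ j`); moreover, such a family can be constructed
  in time `poly(2^d, m)`";
* Nisan–Wigderson, JCSS 49 (1994), Lemma 2.5 (existence of designs by a greedy/probabilistic
  argument).

This file PROVES the existence statement by the textbook counting argument behind the greedy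
construction (which is also what makes the `poly(2^d, m)`-time construction work: at every step a
good block exists among all `ℓ`-subsets of `[d]`):

* `card_filter_superset_le` — an `a`-set `A ⊆ [d]` has at most `C(d-a, ℓ-a)` supersets of size `ℓ`;
* `card_filter_badInter_le` — a block `T` of size `ℓ` meets at most `C(ℓ, ρ+1) · C(d-ρ-1, ℓ-ρ-1)`
  of the `ℓ`-subsets of `[d]` in `> ρ` points;
* `exists_isNWDesign_of_mul_lt` — **greedy existence**: if
  `m · C(ℓ, ρ+1) · C(d-ρ-1, ℓ-ρ-1) < C(d, ℓ)` then every index set of size `≤ m` carries a design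
  `e i : Fin ℓ ↪ Fin d` with `IsNWDesign ρ e` (pairwise intersections `≤ ρ`);
* `exists_isNWDesign_linear` — **the linear-universe regime**: for `b, ℓ ≥ 1` and any index set of
  size `≤ 2^ℓ` there is a design with blocks `Fin ℓ`, intersections `≤ ℓ / b` and universe
  `Fin ((ℓ / b + 1) * 8 ^ b)` (so `d ≤ 2 · 8^b · ℓ`); via `C(ℓ, ρ+1)² · 2^ℓ ≤ 8^ℓ < 8^{b(ρ+1)} ≤ C(d, ρ+1)`
  (`pow_le_choose_mul`: `K^s ≤ C(sK, s)`) and the identity `C(d,ℓ) C(ℓ,s) = C(d,s) C(d-s, ℓ-s)`.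

## References

* S. Hirahara, *NP-hardness of learning programs and partial MCSP*, ECCC TR22-119 (2022),
  Prop. 6.2 (p. 19) [Hirahara2022PartialMCSP].
* N. Nisan, A. Wigderson, *Hardness vs randomness*, J. Comput. Syst. Sci. 49 (1994) 149–167,
  Lemma 2.5.
* L. Trevisan, *Extractors and pseudorandom generators*, J. ACM 48 (2001), §2 (designs, "weak
  designs").
-/

namespace Literature.Computability.MetaComplexity

open Finset

namespace NWDesignCount

variable {d : ℕ}

/-! ### Counting supersets and bad intersections -/

/-- An `a`-subset `A ⊆ [d]` has at most `C(d - a, ℓ - a)` supersets of size `ℓ` (exactly that many;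
we only need the bound): `S ↦ S \ A` lands in the `(ℓ-a)`-subsets of `Aᶜ`. [folklore] -/
theorem card_filter_superset_le (ℓ : ℕ) (A : Finset (Fin d)) :
    ((univ : Finset (Fin d)).powersetCard ℓ |>.filter fun S => A ⊆ S).card ≤
      (d - A.card).choose (ℓ - A.card) := by
  have h : ((univ : Finset (Fin d)).powersetCard ℓ).filter (fun S => A ⊆ S) ⊆
      (Aᶜ.powersetCard (ℓ - A.card)).image fun T => A ∪ T := by
    intro S hS
    rw [mem_filter, mem_powersetCard] at hS
    rw [mem_image]
    refine ⟨S \ A, ?_, Finset.union_sdiff_of_subset hS.2⟩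
    rw [mem_powersetCard]
    refine ⟨fun x hx => ?_, ?_⟩
    · rw [mem_compl]
      exact (mem_sdiff.1 hx).2
    · rw [card_sdiff_of_subset hS.2, hS.1.2]
  refine (card_le_card h).trans (card_image_le.trans ?_)
  rw [card_powersetCard, card_compl, Fintype.card_fin]

/-- A block `T` of size `ℓ` meets at most `C(ℓ, ρ+1) · C(d-ρ-1, ℓ-ρ-1)` of the `ℓ`-subsets of `[d]`
in more than `ρ` points (union bound over the `(ρ+1)`-subsets `A ⊆ S ∩ T`).
[cite: Hirahara2022PartialMCSP, Prop. 6.2 (proof, counting step)] -/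
theorem card_filter_badInter_le (ℓ ρ : ℕ) {T : Finset (Fin d)} (hT : T.card = ℓ) :
    (((univ : Finset (Fin d)).powersetCard ℓ).filter fun S => ρ + 1 ≤ (S ∩ T).card).card ≤
      ℓ.choose (ρ + 1) * (d - (ρ + 1)).choose (ℓ - (ρ + 1)) := by
  have h : ((univ : Finset (Fin d)).powersetCard ℓ).filter (fun S => ρ + 1 ≤ (S ∩ T).card) ⊆
      (T.powersetCard (ρ + 1)).biUnion fun A =>
        ((univ : Finset (Fin d)).powersetCard ℓ).filter fun S => A ⊆ S := by
    intro S hS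
    rw [mem_filter] at hS
    obtain ⟨A, hA, hAc⟩ := Finset.exists_subset_card_eq hS.2
    rw [mem_biUnion]
    refine ⟨A, mem_powersetCard.2 ⟨hA.trans inter_subset_right, hAc⟩, ?_⟩
    rw [mem_filter]
    exact ⟨hS.1, hA.trans inter_subset_left⟩
  refine (card_le_card h).trans (card_biUnion_le.trans ?_)
  calc ∑ A ∈ T.powersetCard (ρ + 1),
        (((univ : Finset (Fin d)).powersetCard ℓ).filter fun S => A ⊆ S).card
      ≤ ∑ _A ∈ T.powersetCard (ρ + 1), (d - (ρ + 1)).choose (ℓ - (ρ + 1)) :=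
        sum_le_sum fun A hA => by
          have hAc : A.card = ρ + 1 := (mem_powersetCard.1 hA).2
          simpa [hAc] using card_filter_superset_le ℓ A
    _ = ℓ.choose (ρ + 1) * (d - (ρ + 1)).choose (ℓ - (ρ + 1)) := by
        rw [sum_const, card_powersetCard, hT, smul_eq_mul]

/-! ### Greedy existence -/

/-- **Greedy step / induction.** If `m · C(ℓ, ρ+1) · C(d-ρ-1, ℓ-ρ-1) < C(d, ℓ)`, then for every
`i ≤ m` there are `i` blocks of size `ℓ` in `[d]` with pairwise intersections `≤ ρ`: the blocks
meeting one of `i < m` chosen blocks badly are fewer than all `ℓ`-subsets.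
[cite: Hirahara2022PartialMCSP, Prop. 6.2 ("can be constructed in time poly(2^d, m)": greedy)] -/
theorem exists_blocks {ℓ ρ m : ℕ}
    (h : m * (ℓ.choose (ρ + 1) * (d - (ρ + 1)).choose (ℓ - (ρ + 1))) < d.choose ℓ) :
    ∀ i ≤ m, ∃ T : Fin i → Finset (Fin d), (∀ a, (T a).card = ℓ) ∧
      ∀ a a', a ≠ a' → (T a ∩ T a').card ≤ ρ
  | 0, _ => ⟨Fin.elim0, fun a => a.elim0, fun a => a.elim0⟩
  | i + 1, hi => by
    obtain ⟨T, hT, hTT⟩ := exists_blocks h i (Nat.le_of_succ_le hi)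
    -- the bad `ℓ`-subsets: those meeting some chosen block in `> ρ` points
    set bad := ((univ : Finset (Fin d)).powersetCard ℓ).filter
      fun S => ∃ a, ρ + 1 ≤ (S ∩ T a).card with hbad
    have hbad_le : bad.card ≤ i * (ℓ.choose (ρ + 1) * (d - (ρ + 1)).choose (ℓ - (ρ + 1))) := by
      have hsub : bad ⊆ (univ : Finset (Fin i)).biUnion fun a =>
          ((univ : Finset (Fin d)).powersetCard ℓ).filter fun S => ρ + 1 ≤ (S ∩ T a).card := by
        intro S hS
        rw [hbad, mem_filter] at hS
        obtain ⟨a, ha⟩ := hS.2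
        exact mem_biUnion.2 ⟨a, mem_univ _, mem_filter.2 ⟨hS.1, ha⟩⟩
      refine (card_le_card hsub).trans (card_biUnion_le.trans ?_)
      calc ∑ a : Fin i, (((univ : Finset (Fin d)).powersetCard ℓ).filter
              fun S => ρ + 1 ≤ (S ∩ T a).card).card
          ≤ ∑ _a : Fin i, ℓ.choose (ρ + 1) * (d - (ρ + 1)).choose (ℓ - (ρ + 1)) :=
            sum_le_sum fun a _ => card_filter_badInter_le ℓ ρ (hT a)
        _ = i * (ℓ.choose (ρ + 1) * (d - (ρ + 1)).choose (ℓ - (ρ + 1))) := by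
            rw [sum_const, card_univ, Fintype.card_fin, smul_eq_mul]
    have hlt : bad.card < ((univ : Finset (Fin d)).powersetCard ℓ).card := by
      rw [card_powersetCard, card_univ, Fintype.card_fin]
      refine lt_of_le_of_lt (hbad_le.trans ?_) h
      exact Nat.mul_le_mul_right _ (by omega)
    -- hence a good block exists
    obtain ⟨S, hS, hSbad⟩ := exists_mem_notMem_of_card_lt_card hlt
    have hSℓ : S.card = ℓ := (mem_powersetCard.1 hS).2
    have hSgood : ∀ a, (S ∩ T a).card ≤ ρ := fun a => by
      by_contra hc
      exact hSbad (mem_filter.2 ⟨hS, a, by omega⟩)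
    refine ⟨Fin.snoc T S, fun a => ?_, fun a a' hne => ?_⟩
    · refine Fin.lastCases ?_ (fun a => ?_) a
      · simpa using hSℓ
      · simpa using hT a
    · induction a using Fin.lastCases with
      | last =>
        induction a' using Fin.lastCases with
        | last => exact absurd rfl hne
        | cast b' =>
          simp only [Fin.snoc_last, Fin.snoc_castSucc]
          exact hSgood b'
      | cast b =>
        induction a' using Fin.lastCases with
        | last =>
          simp only [Fin.snoc_last, Fin.snoc_castSucc]
          rw [inter_comm]
          exact hSgood b
        | cast b' =>
          simp only [Fin.snoc_castSucc]
          exact hTT b b' fun heq => hne (by rw [heq])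

/-! ### The linear-universe regime -/

/-- `K^s ≤ C(s·K, s)`: choosing one element in each of `s` disjoint blocks of size `K` gives
distinct `s`-subsets. [folklore] -/
theorem pow_le_choose_mul (K s : ℕ) : K ^ s ≤ (s * K).choose s := by
  classical
  -- `g : Fin s → Fin K` ↦ its graph, an `s`-subset of `Fin s × Fin K`
  set graph : (Fin s → Fin K) → Finset (Fin s × Fin K) := fun g => univ.image fun i => (i, g i)
    with hgraph
  have hmem : ∀ g, graph g ∈ (univ : Finset (Fin s × Fin K)).powersetCard s := fun g => by
    rw [mem_powersetCard]
    refine ⟨subset_univ _, ?_⟩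
    rw [hgraph, card_image_of_injective _ fun i j hij => (Prod.ext_iff.1 hij).1, card_univ,
      Fintype.card_fin]
  have hinj : Set.InjOn graph (univ : Finset (Fin s → Fin K)) := by
    intro g _ g' _ hgg'
    funext i
    have hi : (i, g i) ∈ graph g' := by
      rw [← hgg']
      exact mem_image.2 ⟨i, mem_univ _, rfl⟩
    obtain ⟨j, -, hj⟩ := mem_image.1 hi
    obtain ⟨rfl, h2⟩ := Prod.ext_iff.1 hj
    exact h2.symm
  have hcard := card_le_card_of_injOn graph (fun g _ => hmem g) hinj
  rwa [card_univ, Fintype.card_fun, Fintype.card_fin, Fintype.card_fin, card_powersetCard,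
    card_univ, Fintype.card_prod, Fintype.card_fin, Fintype.card_fin] at hcard

/-- The counting condition, rewritten: `m · C(ℓ,s) · C(d-s, ℓ-s) < C(d,ℓ)` follows from
`m · C(ℓ,s)² < C(d,s)` (`s ≤ ℓ ≤ d`), by `C(d,ℓ) C(ℓ,s) = C(d,s) C(d-s,ℓ-s)`. [folklore] -/
theorem mul_choose_lt_of_sq {ℓ s m : ℕ} (hsℓ : s ≤ ℓ) (hℓd : ℓ ≤ d)
    (h : m * ℓ.choose s ^ 2 < d.choose s) :
    m * (ℓ.choose s * (d - s).choose (ℓ - s)) < d.choose ℓ := by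
  have hid : d.choose ℓ * ℓ.choose s = d.choose s * (d - s).choose (ℓ - s) := Nat.choose_mul hsℓ
  have hpos : 0 < d.choose ℓ := Nat.choose_pos hℓd
  have hcs : 0 < ℓ.choose s := Nat.choose_pos hsℓ
  -- multiply the claim by `C(d, s) > 0` hmm, rather by `C(ℓ, s)`... we compare after multiplying by `C(d,ℓ)`
  by_contra hcon
  rw [not_lt] at hcon
  -- `C(d,ℓ) ≤ m C(ℓ,s) C(d-s,ℓ-s)`; multiply by `C(ℓ,s)`:
  have h1 : d.choose ℓ * ℓ.choose s ≤ m * ℓ.choose s ^ 2 * (d - s).choose (ℓ - s) := by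
    calc d.choose ℓ * ℓ.choose s ≤ m * (ℓ.choose s * (d - s).choose (ℓ - s)) * ℓ.choose s :=
          Nat.mul_le_mul_right _ hcon
      _ = m * ℓ.choose s ^ 2 * (d - s).choose (ℓ - s) := by ring
  rw [hid] at h1
  -- so `C(d,s) · X ≤ m C(ℓ,s)² · X` with `X = C(d-s, ℓ-s) > 0`
  have hX : 0 < (d - s).choose (ℓ - s) := Nat.choose_pos (by omega)
  have h2 : d.choose s ≤ m * ℓ.choose s ^ 2 := Nat.le_of_mul_le_mul_right h1 hX
  exact absurd h (not_lt.2 h2)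

end NWDesignCount

open NWDesignCount

/-! ### The existence theorems -/

/-- **Existence of designs by counting (greedy form of NW94, Lemma 2.5 / Hirahara 2022,
Prop. 6.2).** If `m · C(ℓ, ρ+1) · C(d-ρ-1, ℓ-ρ-1) < C(d, ℓ)`, then any index set of size `≤ m`
carries a family of blocks `e i : Fin ℓ ↪ Fin d` with pairwise intersections `≤ ρ`
(`IsNWDesign ρ e`). [cite: Hirahara2022PartialMCSP, Prop. 6.2] -/
theorem exists_isNWDesign_of_mul_lt {d ℓ ρ m : ℕ} (ι : Type*) [Fintype ι] (hι : Fintype.card ι ≤ m)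
    (h : m * (ℓ.choose (ρ + 1) * (d - (ρ + 1)).choose (ℓ - (ρ + 1))) < d.choose ℓ) :
    ∃ e : ι → (Fin ℓ ↪ Fin d), IsNWDesign ρ e := by
  classical
  obtain ⟨T, hT, hTT⟩ := exists_blocks h (Fintype.card ι) hι
  set idx := Fintype.equivFin ι
  refine ⟨fun i => ((T (idx i)).orderEmbOfFin (hT (idx i))).toEmbedding, fun i j hij => ?_⟩
  -- a block `T` of size `ℓ`, enumerated increasingly (`Finset.orderEmbOfFin`), has range `T`
  rw [Finset.map_orderEmbOfFin_univ, Finset.map_orderEmbOfFin_univ]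
  exact hTT _ _ fun heq => hij (idx.injective heq)

/-- **Designs with a linear universe** (the regime of Hirahara 2022, Prop. 6.2 with `ρ = ℓ/(2c)`,
and of the Impagliazzo–Wigderson "nearly disjoint" generator with `ρ = γℓ`): for `b, ℓ ≥ 1` and any
index set of at most `2^ℓ` blocks there is a design with blocks of size `ℓ`, pairwise
intersections `≤ ℓ / b`, in the universe `Fin ((ℓ / b + 1) · 8^b)` of size `≤ 2 · 8^b · ℓ`.
[cite: Hirahara2022PartialMCSP, Prop. 6.2] -/
theorem exists_isNWDesign_linear {b ℓ : ℕ} (hb : 1 ≤ b) (hℓ : 1 ≤ ℓ) (ι : Type*) [Fintype ι]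
    (hι : Fintype.card ι ≤ 2 ^ ℓ) :
    ∃ e : ι → (Fin ℓ ↪ Fin ((ℓ / b + 1) * 8 ^ b)), IsNWDesign (ℓ / b) e := by
  rcases Nat.eq_or_lt_of_le hb with rfl | hb2
  · -- `b = 1`: intersections `≤ ℓ` hold for any family of `ℓ`-blocks
    have hℓd : ℓ ≤ (ℓ / 1 + 1) * 8 ^ 1 := by rw [Nat.div_one]; omega
    refine ⟨fun _ => Fin.castLEEmb hℓd, fun i j _ => ?_⟩
    calc (univ.map (Fin.castLEEmb hℓd) ∩ univ.map (Fin.castLEEmb hℓd)).card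
        ≤ (univ.map (Fin.castLEEmb hℓd)).card := card_le_card inter_subset_left
      _ = ℓ := by rw [card_map, card_univ, Fintype.card_fin]
      _ = ℓ / 1 := (Nat.div_one ℓ).symm
  · -- `b ≥ 2`: the counting condition with `s = ρ + 1`, `d = s · 8^b`
    set ρ := ℓ / b with hρ
    set s := ρ + 1 with hs
    have hρℓ : ρ < ℓ := Nat.div_lt_self hℓ hb2
    have hsℓ : s ≤ ℓ := by omega
    have hbs : ℓ < b * s := by rw [hs, hρ]; exact Nat.lt_mul_div_succ ℓ (by omega)
    have h8b : b ≤ 8 ^ b := (Nat.lt_pow_self (by norm_num : 1 < 8)).le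
    have hℓd : ℓ ≤ s * 8 ^ b := by nlinarith
    refine exists_isNWDesign_of_mul_lt ι hι (mul_choose_lt_of_sq hsℓ hℓd ?_)
    -- `2^ℓ · C(ℓ,s)² ≤ 8^ℓ < 8^{b s} ≤ C(s 8^b, s)`
    have hc : ℓ.choose s ≤ 2 ^ ℓ := Nat.choose_le_two_pow ℓ s
    calc 2 ^ ℓ * ℓ.choose s ^ 2 ≤ 2 ^ ℓ * (2 ^ ℓ) ^ 2 := by gcongr
      _ = 8 ^ ℓ := by rw [← pow_mul, ← pow_add, show (8 : ℕ) = 2 ^ 3 by norm_num, ← pow_mul]; ring_nf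
      _ < 8 ^ (b * s) := Nat.pow_lt_pow_right (by norm_num) hbs
      _ = (8 ^ b) ^ s := by rw [pow_mul]
      _ ≤ (s * 8 ^ b).choose s := pow_le_choose_mul _ _

end Literature.Computability.MetaComplexity
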